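import Mathlib.MeasureTheory.Function.LpSeminorm.Count
import Mathlib.Analysis.SpecialFunctions.Pow.Asymptotics
import Literature.Analysis.FunctionSpaces.BesovPairing
import Literature.Analysis.FunctionSpaces.LittlewoodPaleyHeatContinuity
import Literature.Analysis.FunctionSpaces.LittlewoodPaleyHeatProofs
import Literature.Analysis.FunctionSpaces.LittlewoodPaleyProofs
import HarnessLib

/-!
# Critical rescalings of an element of `Ḃ^s_{p,q}`, `q < ∞`, tend to zero in `𝓢'`

Analysis/FunctionSpaces proof file (theorems only: no definition, no named fact). For a tempered
distribution `u ∈ Ḃ^s_{p,q}(E; F) ∩ 𝓢'_h` with `-2 < s < 0`, `1 ≤ p ≤ ∞` and **finite third index**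
`0 < q < ∞`, the *critically normalised* dyadic zooms

  `u_{j₀} := 2^{j₀ (d/p - s)} u(2^{j₀} ·)`,   `d = dim E`,

which all have the same `Ḃ^s_{p,r}` norms as `u` (Bahouri–Chemin–Danchin 2011, Prop. 2.18:
`‖u(2^{j₀} ·)‖_{Ḃ^s_{p,r}} = 2^{j₀ (s - d/p)} ‖u‖_{Ḃ^s_{p,r}}`), tend to `0` in `𝓢'(E, F)` as
`j₀ → -∞` (`tendsto_rpow_smul_distribDilate_atBot`), i.e. `⟨u_{j₀}, θ⟩ → 0` for every Schwartz
`θ` (`tendsto_rpow_smul_distribDilate_apply_atBot`); also along `k ↦ j₀ = -k`, `k → ∞` in `ℕ`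
(`tendsto_rpow_smul_distribDilate_neg_natCast_atTop`).

This is the function-space lemma behind the step "the blow-up limit vanishes at the final time"
of every blow-up proof of the critical *Besov* regularity criteria for the Navier–Stokes
equations — the point where `q < ∞` is used:

* D. Albritton, *Blow-up criteria for the Navier–Stokes equations in non-endpoint critical Besov
  spaces*, Anal. PDE 11 (2018) = arXiv:1612.04439, §3, Step 2, display (rescalevanish):
  "`⟨u^{(n)}(·,1), φ⟩ = ⟨u(·,1), λₙ⁻² φ(·/λₙ)⟩ → 0` … a consequence of the density of Schwartz
  functions in `Ḃ^{s_p}_{p,p}`"; here `u^{(n)} = λₙ u(λₙ ·)`, `λₙ → 0`, `s_p = -1 + 3/p`, so that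
  `d/p - s_p = 1`;
* W. Wang, Z. Zhang, *Blow-up of critical norms for the 3-D Navier–Stokes equations*, Sci. China
  Math. 60 (2017) = arXiv:1510.02589, §4 Step 2 (`v(x, 0) = 0` from the vanishing of the critical
  rescalings of the final-time profile);
* I. Gallagher, G. S. Koch, F. Planchon, Comm. Math. Phys. 343 (2016) = arXiv:1407.4156, p. 5:
  the restriction `q < ∞` "to ensure that critical elements tend to zero at blow-up time"; the
  statement is false for `q = ∞` (the `-1`-homogeneous profile `|x|⁻¹ ∈ Ḃ^{s_p}_{p,∞}` is a fixed
  point of the critical rescaling).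

## The proof (glue of accepted tree theorems; no density argument)

Fix `θ ∈ 𝓢` and `ε > 0`. Split `u = e^{t₀Δ}u - h`, `h := e^{t₀Δ}u - u`, with `t₀ > 0` so small
that `‖h‖_{Ḃ^s_{p,q}} ≤ η` (strong continuity of the heat semigroup on `Ḃ^s_{p,q}` for `q < ∞`,
`MemHomBesov.tendsto_eHomBesovNorm_heatSemigroup_sub_self` — this is where `q < ∞` enters).
* *High frequencies.* The zooms `h(2^{j₀} ·)` are realised, with
  `‖h(2^{j₀} ·)‖_{Ḃ^s_{p,∞}} = 2^{j₀(s - d/p)} ‖h‖_{Ḃ^s_{p,∞}}` (`eHomBesovNorm_distribDilate_holds`),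
  so by the pairing bound `‖⟨W, θ⟩‖ ≤ K_θ ‖W‖_{Ḃ^s_{p,∞}}` of realised distributions, `-2 < s < 0`
  (`exists_nnnorm_apply_le_mul_eHomBesovNorm`, BCD Prop. 2.27),
  `‖⟨2^{j₀(d/p - s)} h(2^{j₀} ·), θ⟩‖ ≤ K_θ ‖h‖_{Ḃ^s_{p,∞}} ≤ K_θ η` for **every** `j₀`.
* *Low frequencies.* `e^{t₀Δ}u ∈ L^p` (`‖e^{tΔ}u‖_{L^p} ≤ C t^{s/2} ‖u‖_{Ḃ^s_{p,∞}}`,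
  `exists_eLpNormDistrib_heatSemigroup_le_rpow_mul_eHomBesovNorm`, BCD Thm. 2.34), and
  `‖w(2^{j₀} ·)‖_{L^p} = 2^{-j₀ d/p} ‖w‖_{L^p}` (`eLpNormDistrib_distribDilate`), so by Hölder
  `‖⟨2^{j₀(d/p - s)} (e^{t₀Δ}u)(2^{j₀} ·), θ⟩‖ ≤ 2^{-j₀ s} ‖θ‖_{L^{p'}} ‖e^{t₀Δ}u‖_{L^p} → 0` as
  `j₀ → -∞` (`s < 0`).
Hence `limsup ‖⟨u_{j₀}, θ⟩‖ ≤ K_θ η` for every `η > 0`.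

## References

* H. Bahouri, J.-Y. Chemin, R. Danchin, *Fourier Analysis and Nonlinear Partial Differential
  Equations*, Grundlehren 343 (2011), Prop. 2.18, Prop. 2.27, Thm. 2.34, Lemma 2.4.
  [BahouriCheminDanchin2011]
* D. Albritton, Anal. PDE 11 (2018) 1415–1456 = arXiv:1612.04439, §3 Step 2. [Albritton2018]
* W. Wang, Z. Zhang, Sci. China Math. 60 (2017) 637–650 = arXiv:1510.02589, §4 Step 2.
  [WangZhang2016]
* I. Gallagher, G. S. Koch, F. Planchon, Comm. Math. Phys. 343 (2016) 39–82 = arXiv:1407.4156,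
  p. 5 and Prop. 2.2. [GKP2016]
-/

noncomputable section

open MeasureTheory TemperedDistribution Filter Set Function
open _root_.Topology
open scoped SchwartzMap ENNReal NNReal

namespace Literature.Analysis.FunctionSpaces

variable {E : Type*} [NormedAddCommGroup E] [InnerProductSpace ℝ E] [FiniteDimensional ℝ E]
  [MeasurableSpace E] [BorelSpace E] {F : Type*} [NormedAddCommGroup F] [NormedSpace ℂ F]
  [CompleteSpace F]

/-! ## Two small order facts -/

/-- The `Ḃ^s_{p,∞}` norm is dominated by every `Ḃ^s_{p,q}` norm, `q ≠ 0` (each Besov weight is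
bounded by the `ℓ^q` norm of the weight sequence; BCD Prop. 2.20, third-index embedding with
constant one). [folklore] -/
theorem eHomBesovNorm_top_le_eHomBesovNorm (s : ℝ) (p : ℝ≥0∞) [Fact (1 ≤ p)] {q : ℝ≥0∞}
    (hq : q ≠ 0) (u : 𝓢'(E, F)) : eHomBesovNorm s p ∞ u ≤ eHomBesovNorm s p q u := by
  rw [eHomBesovNorm_top]
  refine iSup_le fun j => ?_
  have h := enorm_le_eLpNorm_count (lpBlockWeight s p u) j hq
  rw [enorm_eq_self] at h
  exact h

omit [InnerProductSpace ℝ E] [FiniteDimensional ℝ E] [MeasurableSpace E] [BorelSpace E]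
  [NormedSpace ℂ F] [CompleteSpace F] in
/-- From an `ℝ≥0∞` bound `‖x‖₊ ≤ K N` with `N < ∞` to the real bound `‖x‖ ≤ K N.toReal`.
[folklore] -/
theorem norm_le_mul_toReal_of_ennnorm_le {x : F} {K : ℝ≥0} {N : ℝ≥0∞} (hN : N ≠ ⊤)
    (h : (‖x‖₊ : ℝ≥0∞) ≤ K * N) : ‖x‖ ≤ K * N.toReal := by
  have h' := ENNReal.toReal_mono (ENNReal.mul_ne_top ENNReal.coe_ne_top hN) h
  rwa [ENNReal.toReal_mul, ENNReal.coe_toReal, ENNReal.coe_toReal, coe_nnnorm] at h'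

/-! ## The scalar bookkeeping of the critical zoom -/

omit [FiniteDimensional ℝ E] [MeasurableSpace E] [BorelSpace E] [CompleteSpace F] in
/-- The norm of `⟨c • W, θ⟩` for a nonnegative real scalar `c`: `‖(c • W) θ‖ = c ‖W θ‖`. [folklore] -/
theorem norm_real_smul_apply (W : 𝓢'(E, F)) {c : ℝ} (hc : 0 ≤ c) (θ : 𝓢(E, ℂ)) :
    ‖((c : ℂ) • W) θ‖ = c * ‖W θ‖ := by
  rw [smul_apply, norm_smul, Complex.norm_real, Real.norm_eq_abs,
    abs_of_nonneg hc]

/-- `2^{j₀ a} · 2^{j₀ b} = 2^{j₀ (a + b)}` in `ℝ`. [folklore] -/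
theorem two_rpow_int_mul_mul (j₀ : ℤ) (a b : ℝ) :
    (2 : ℝ) ^ ((j₀ : ℝ) * a) * (2 : ℝ) ^ ((j₀ : ℝ) * b) = (2 : ℝ) ^ ((j₀ : ℝ) * (a + b)) := by
  rw [← Real.rpow_add two_pos]
  ring_nf

/-- `2^{j₀ σ} → 0` as `j₀ → -∞` for `σ > 0`. [folklore] -/
theorem tendsto_two_rpow_int_mul_atBot {σ : ℝ} (hσ : 0 < σ) :
    Tendsto (fun j₀ : ℤ => (2 : ℝ) ^ ((j₀ : ℝ) * σ)) atBot (𝓝 0) := by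
  have h1 : Tendsto (fun j₀ : ℤ => (j₀ : ℝ) * σ) atBot atBot :=
    (tendsto_intCast_atBot_iff.2 tendsto_id).atBot_mul_const hσ
  exact (tendsto_rpow_atBot_of_base_gt_one 2 one_lt_two).comp h1

/-! ## The main theorem -/

/-- **Critical rescalings of an element of `Ḃ^s_{p,q}`, `q < ∞`, tend to zero in `𝓢'`**
(Albritton 2018, §3 Step 2 (rescalevanish); Wang–Zhang 2017, §4 Step 2; GKP 2016, p. 5): for
`u ∈ Ḃ^s_{p,q}(E; F)` with `-2 < s < 0`, `1 ≤ p ≤ ∞`, `0 < q < ∞` (membership includes the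
realisation `Ṡ_j u → 0`, `j → -∞`), the critically normalised dyadic zooms
`2^{j₀(d/p - s)} u(2^{j₀} ·)` tend to `0` in `𝓢'(E, F)` as `j₀ → -∞`. See the module docstring for
the proof (heat-flow splitting; no density argument). [cite: Albritton2018, §3 Step 2] -/
theorem tendsto_rpow_smul_distribDilate_atBot {s : ℝ} {p q : ℝ≥0∞} [Fact (1 ≤ p)]
    (hs : -2 < s) (hs0 : s < 0) (hq₀ : q ≠ 0) (hq : q ≠ ⊤) {u : 𝓢'(E, F)}
    (hu : MemHomBesov s p q u) :
    Tendsto (fun j₀ : ℤ =>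
      (((2 : ℝ) ^ ((j₀ : ℝ) * (Module.finrank ℝ E / p.toReal - s)) : ℝ) : ℂ) •
        distribDilate (Units.mk0 ((2 : ℝ) ^ j₀) (zpow_ne_zero j₀ two_ne_zero)) u)
      atBot (𝓝 0) := by
  -- exponents
  set d : ℕ := Module.finrank ℝ E with hd
  set a : ℝ := (d : ℝ) / p.toReal - s with ha
  set σ : ℝ := -s with hσdef
  have hσ : 0 < σ := by rw [hσdef]; linarith
  have hσ2 : σ < 2 := by rw [hσdef]; linarith
  have hσs : -σ = s := by rw [hσdef, neg_neg]
  have ha0 : 0 ≤ a := by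
    have : 0 ≤ (d : ℝ) / p.toReal := by positivity
    rw [ha]; linarith
  -- the conjugate exponent of `p`, for Hölder and for the pairing bound
  haveI : p.HolderConjugate (1 - p⁻¹)⁻¹ :=
    ENNReal.HolderConjugate.inv_one_sub_inv' (Fact.out : 1 ≤ p)
  -- pointwise (weak-*) convergence suffices
  rw [PointwiseConvergenceCLM.tendsto_iff_forall_tendsto]
  intro θ
  rw [zero_apply, NormedAddGroup.tendsto_nhds_zero]
  intro ε hε
  -- the pairing constant `K = K(p, σ, θ)` (BCD Prop. 2.27)
  obtain ⟨K, hK⟩ :=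
    exists_nnnorm_apply_le_mul_eHomBesovNorm (E := E) (F := F) p (1 - p⁻¹)⁻¹ hσ hσ2 θ
  -- the smallness level of the high-frequency part
  set η : ℝ := ε / (2 * ((K : ℝ) + 1)) with hη
  have hK0 : (0 : ℝ) ≤ K := K.coe_nonneg
  have hη0 : 0 < η := by rw [hη]; positivity
  have hKη : (K : ℝ) * η ≤ ε / 2 := by
    rw [hη, mul_div_assoc', div_le_div_iff₀ (by positivity) (by positivity)]
    nlinarith
  -- a heat time `t₀ > 0` with `‖e^{t₀Δ}u - u‖_{Ḃ^s_{p,q}} ≤ η` (strong continuity, `q < ∞`)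
  have hcont := hu.tendsto_eHomBesovNorm_heatSemigroup_sub_self hq₀ hq
  have hev : ∀ᶠ t in 𝓝[>] (0 : ℝ),
      eHomBesovNorm s p q (TemperedDistribution.heatSemigroup t u - u) ≤ ENNReal.ofReal η :=
    (ENNReal.tendsto_nhds_zero.1 hcont (ENNReal.ofReal η) (ENNReal.ofReal_pos.2 hη0)).filter_mono
      (nhdsWithin_mono _ Ioi_subset_Ici_self)
  obtain ⟨t₀, ht₀η, ht₀⟩ := (hev.and self_mem_nhdsWithin).exists
  replace ht₀ : 0 < t₀ := ht₀
  -- the split `u = L - h`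
  set L : 𝓢'(E, F) := TemperedDistribution.heatSemigroup t₀ u with hL
  set h : 𝓢'(E, F) := TemperedDistribution.heatSemigroup t₀ u - u with hh
  have hsplit : u = L - h := by rw [hh, hL, sub_sub_cancel]
  -- ### the high-frequency part `h`: realised, of `Ḃ^s_{p,q}` norm `≤ η`
  have hh_real : Tendsto (fun j : ℤ => lowFreqCutoff j h) atBot (𝓝 0) := by
    have h1 := (tendsto_lowFreqCutoff_heatSemigroup_atBot hu.2 ht₀.le).sub hu.2
    rw [sub_zero] at h1
    refine h1.congr fun j => ?_
    rw [hh, map_sub]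
  have hh_norm : eHomBesovNorm s p q h ≤ ENNReal.ofReal η := ht₀η
  have hh_mem : MemHomBesov s p q h := ⟨hh_norm.trans_lt ENNReal.ofReal_lt_top, hh_real⟩
  have hh_top : (eHomBesovNorm s p ∞ h).toReal ≤ η :=
    ENNReal.toReal_le_of_le_ofReal hη0.le
      ((eHomBesovNorm_top_le_eHomBesovNorm s p hq₀ h).trans hh_norm)
  -- the pairing bound for every zoom of `h`, uniformly in `j₀`
  have hhigh : ∀ j₀ : ℤ, ‖((((2 : ℝ) ^ ((j₀ : ℝ) * a) : ℝ) : ℂ) •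
      distribDilate (Units.mk0 ((2 : ℝ) ^ j₀) (zpow_ne_zero j₀ two_ne_zero)) h) θ‖ ≤
      (K : ℝ) * η := by
    intro j₀
    set W : 𝓢'(E, F) := distribDilate (Units.mk0 ((2 : ℝ) ^ j₀) (zpow_ne_zero j₀ two_ne_zero)) h
      with hW
    have hWmem : MemHomBesov s p q W := MemHomBesov.distribDilate_holds hh_mem j₀
    -- `‖W‖_{Ḃ^s_{p,∞}} = 2^{j₀(s - d/p)} ‖h‖_{Ḃ^s_{p,∞}}`
    have hWnorm : eHomBesovNorm s p ∞ W =
        (2 : ℝ≥0∞) ^ ((j₀ : ℝ) * (s - d / p.toReal)) * eHomBesovNorm s p ∞ h :=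
      eHomBesovNorm_distribDilate_holds s p ∞ j₀ h
    have hWtop : eHomBesovNorm s p ∞ W ≠ ⊤ := by
      rw [hWnorm]
      exact ENNReal.mul_ne_top (ENNReal.rpow_ne_top_of_ne_zero two_ne_zero ENNReal.ofNat_ne_top)
        (((eHomBesovNorm_top_le_eHomBesovNorm s p hq₀ h).trans hh_norm).trans_lt
          ENNReal.ofReal_lt_top).ne
    -- the pairing bound (BCD Prop. 2.27)
    have hpair : ‖W θ‖ ≤ (K : ℝ) * (eHomBesovNorm s p ∞ W).toReal := by
      have h1 := hK W hWmem.2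
      rw [hσs] at h1
      exact norm_le_mul_toReal_of_ennnorm_le hWtop h1
    have hWreal : (eHomBesovNorm s p ∞ W).toReal =
        (2 : ℝ) ^ ((j₀ : ℝ) * (s - d / p.toReal)) * (eHomBesovNorm s p ∞ h).toReal := by
      rw [hWnorm, ENNReal.toReal_mul, ← ENNReal.toReal_rpow, ENNReal.toReal_ofNat]
    rw [norm_real_smul_apply W (Real.rpow_nonneg zero_le_two _) θ]
    calc (2 : ℝ) ^ ((j₀ : ℝ) * a) * ‖W θ‖
        ≤ (2 : ℝ) ^ ((j₀ : ℝ) * a) * ((K : ℝ) * ((2 : ℝ) ^ ((j₀ : ℝ) * (s - d / p.toReal)) *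
            (eHomBesovNorm s p ∞ h).toReal)) := by
          rw [← hWreal]
          exact mul_le_mul_of_nonneg_left hpair (Real.rpow_nonneg zero_le_two _)
      _ = (K : ℝ) * ((2 : ℝ) ^ ((j₀ : ℝ) * a) * (2 : ℝ) ^ ((j₀ : ℝ) * (s - d / p.toReal))) *
            (eHomBesovNorm s p ∞ h).toReal := by ring
      _ = (K : ℝ) * (eHomBesovNorm s p ∞ h).toReal := by
          rw [two_rpow_int_mul_mul, show a + (s - (d : ℝ) / p.toReal) = 0 by rw [ha]; ring,
            mul_zero, Real.rpow_zero, mul_one]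
      _ ≤ (K : ℝ) * η := mul_le_mul_of_nonneg_left hh_top hK0
  -- ### the low-frequency part `L = e^{t₀Δ}u ∈ L^p`
  obtain ⟨C, hC⟩ :=
    exists_eLpNormDistrib_heatSemigroup_le_rpow_mul_eHomBesovNorm (E := E) (F := F) p hσ
  have hLtop : eLpNormDistrib p L < ⊤ := by
    refine (hC t₀ ht₀ u hu.2).trans_lt ?_
    refine ENNReal.mul_lt_top (ENNReal.mul_lt_top ENNReal.coe_lt_top ENNReal.ofReal_lt_top) ?_
    rw [hσs]
    exact (eHomBesovNorm_top_le_eHomBesovNorm s p hq₀ u).trans_lt hu.1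
  set Λ : ℝ := (eLpNormDistrib p L).toReal with hΛ
  set Θ : ℝ := (eLpNorm (⇑θ) (1 - p⁻¹)⁻¹ (volume : Measure E)).toReal with hΘ
  have hlow : ∀ j₀ : ℤ, ‖((((2 : ℝ) ^ ((j₀ : ℝ) * a) : ℝ) : ℂ) •
      distribDilate (Units.mk0 ((2 : ℝ) ^ j₀) (zpow_ne_zero j₀ two_ne_zero)) L) θ‖ ≤
      (2 : ℝ) ^ ((j₀ : ℝ) * σ) * (Θ * Λ) := by
    intro j₀
    set V : 𝓢'(E, F) := distribDilate (Units.mk0 ((2 : ℝ) ^ j₀) (zpow_ne_zero j₀ two_ne_zero)) L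
      with hV
    -- `‖L(2^{j₀} ·)‖_{L^p} = 2^{-j₀ d / p} ‖L‖_{L^p}`
    have hVnorm : eLpNormDistrib p V = (2 : ℝ≥0∞) ^ (-((j₀ : ℝ) * d) / p.toReal) *
        eLpNormDistrib p L := by
      rw [hV, eLpNormDistrib_distribDilate, Units.val_mk0, dilateConst_two_zpow]
    have hVtop : eLpNormDistrib p V < ⊤ := by
      rw [hVnorm]
      exact ENNReal.mul_lt_top ((ENNReal.rpow_ne_top_of_ne_zero two_ne_zero
        ENNReal.ofNat_ne_top).lt_top) hLtop
    -- Hölder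
    have hpair : ‖V θ‖ ≤ Θ * ((2 : ℝ) ^ (-((j₀ : ℝ) * d) / p.toReal) * Λ) := by
      have h1 := norm_apply_le_of_eLpNormDistrib_lt_top (q := (1 - p⁻¹)⁻¹) hVtop θ
      rw [hVnorm, ENNReal.toReal_mul, ENNReal.toReal_mul, ← ENNReal.toReal_rpow,
        ENNReal.toReal_ofNat] at h1
      exact h1
    rw [norm_real_smul_apply V (Real.rpow_nonneg zero_le_two _) θ]
    calc (2 : ℝ) ^ ((j₀ : ℝ) * a) * ‖V θ‖
        ≤ (2 : ℝ) ^ ((j₀ : ℝ) * a) * (Θ * ((2 : ℝ) ^ (-((j₀ : ℝ) * d) / p.toReal) * Λ)) :=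
          mul_le_mul_of_nonneg_left hpair (Real.rpow_nonneg zero_le_two _)
      _ = ((2 : ℝ) ^ ((j₀ : ℝ) * a) * (2 : ℝ) ^ ((j₀ : ℝ) * (-(d : ℝ) / p.toReal))) *
            (Θ * Λ) := by
          rw [show -((j₀ : ℝ) * d) / p.toReal = (j₀ : ℝ) * (-(d : ℝ) / p.toReal) by ring]
          ring
      _ = (2 : ℝ) ^ ((j₀ : ℝ) * σ) * (Θ * Λ) := by
          rw [two_rpow_int_mul_mul, show a + -(d : ℝ) / p.toReal = σ by rw [ha, hσdef]; ring]
  -- the low-frequency pairings tend to zero (`s < 0`)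
  have hlow0 : Tendsto (fun j₀ : ℤ => (2 : ℝ) ^ ((j₀ : ℝ) * σ) * (Θ * Λ)) atBot (𝓝 0) := by
    simpa only [zero_mul] using (tendsto_two_rpow_int_mul_atBot hσ).mul_const (Θ * Λ)
  -- ### conclusion
  have hev2 : ∀ᶠ j₀ : ℤ in atBot, (2 : ℝ) ^ ((j₀ : ℝ) * σ) * (Θ * Λ) < ε / 2 :=
    (tendsto_order.1 hlow0).2 _ (by positivity)
  filter_upwards [hev2] with j₀ hj₀
  have hdecomp : ((((2 : ℝ) ^ ((j₀ : ℝ) * ((Module.finrank ℝ E : ℝ) / p.toReal - s)) : ℝ) : ℂ) •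
      distribDilate (Units.mk0 ((2 : ℝ) ^ j₀) (zpow_ne_zero j₀ two_ne_zero)) u) θ =
      ((((2 : ℝ) ^ ((j₀ : ℝ) * a) : ℝ) : ℂ) •
        distribDilate (Units.mk0 ((2 : ℝ) ^ j₀) (zpow_ne_zero j₀ two_ne_zero)) L) θ -
      ((((2 : ℝ) ^ ((j₀ : ℝ) * a) : ℝ) : ℂ) •
        distribDilate (Units.mk0 ((2 : ℝ) ^ j₀) (zpow_ne_zero j₀ two_ne_zero)) h) θ := by
    conv_lhs => rw [hsplit]
    rw [map_sub, smul_sub, sub_apply]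
  rw [hdecomp]
  calc ‖((((2 : ℝ) ^ ((j₀ : ℝ) * a) : ℝ) : ℂ) •
          distribDilate (Units.mk0 ((2 : ℝ) ^ j₀) (zpow_ne_zero j₀ two_ne_zero)) L) θ -
        ((((2 : ℝ) ^ ((j₀ : ℝ) * a) : ℝ) : ℂ) •
          distribDilate (Units.mk0 ((2 : ℝ) ^ j₀) (zpow_ne_zero j₀ two_ne_zero)) h) θ‖
      ≤ ‖((((2 : ℝ) ^ ((j₀ : ℝ) * a) : ℝ) : ℂ) •
          distribDilate (Units.mk0 ((2 : ℝ) ^ j₀) (zpow_ne_zero j₀ two_ne_zero)) L) θ‖ +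
        ‖((((2 : ℝ) ^ ((j₀ : ℝ) * a) : ℝ) : ℂ) •
          distribDilate (Units.mk0 ((2 : ℝ) ^ j₀) (zpow_ne_zero j₀ two_ne_zero)) h) θ‖ :=
        norm_sub_le _ _
    _ ≤ (2 : ℝ) ^ ((j₀ : ℝ) * σ) * (Θ * Λ) + (K : ℝ) * η := add_le_add (hlow j₀) (hhigh j₀)
    _ < ε / 2 + ε / 2 := add_lt_add_of_lt_of_le hj₀ hKη
    _ = ε := add_halves ε

/-- **The same, tested against a Schwartz function**: `⟨2^{j₀(d/p - s)} u(2^{j₀} ·), θ⟩ → 0` as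
`j₀ → -∞`, for every `θ ∈ 𝓢(E, ℂ)` (Albritton 2018, §3 Step 2, display (rescalevanish), in the
form `⟨u, λ^{-d}… ⟩`; the dyadic scales `λ = 2^{j₀}`). [cite: Albritton2018, §3 Step 2] -/
theorem tendsto_rpow_smul_distribDilate_apply_atBot {s : ℝ} {p q : ℝ≥0∞} [Fact (1 ≤ p)]
    (hs : -2 < s) (hs0 : s < 0) (hq₀ : q ≠ 0) (hq : q ≠ ⊤) {u : 𝓢'(E, F)}
    (hu : MemHomBesov s p q u) (θ : 𝓢(E, ℂ)) :
    Tendsto (fun j₀ : ℤ =>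
      ((((2 : ℝ) ^ ((j₀ : ℝ) * (Module.finrank ℝ E / p.toReal - s)) : ℝ) : ℂ) •
        distribDilate (Units.mk0 ((2 : ℝ) ^ j₀) (zpow_ne_zero j₀ two_ne_zero)) u) θ)
      atBot (𝓝 0) := by
  have h := (PointwiseConvergenceCLM.tendsto_iff_forall_tendsto.1
    (tendsto_rpow_smul_distribDilate_atBot hs hs0 hq₀ hq hu)) θ
  rwa [zero_apply] at h

/-- **The same along `k ↦ 2^{-k}`, `k → ∞` in `ℕ`**: the critically normalised zooms
`2^{-k(d/p - s)} u(2^{-k} ·)` of `u ∈ Ḃ^s_{p,q}`, `-2 < s < 0`, `0 < q < ∞`, tend to `0` in `𝓢'`.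
[cite: Albritton2018, §3 Step 2] -/
theorem tendsto_rpow_smul_distribDilate_neg_natCast_atTop {s : ℝ} {p q : ℝ≥0∞} [Fact (1 ≤ p)]
    (hs : -2 < s) (hs0 : s < 0) (hq₀ : q ≠ 0) (hq : q ≠ ⊤) {u : 𝓢'(E, F)}
    (hu : MemHomBesov s p q u) :
    Tendsto (fun k : ℕ =>
      (((2 : ℝ) ^ ((((-(k : ℤ) : ℤ) : ℝ)) * (Module.finrank ℝ E / p.toReal - s)) : ℝ) : ℂ) •
        distribDilate (Units.mk0 ((2 : ℝ) ^ (-(k : ℤ))) (zpow_ne_zero _ two_ne_zero)) u)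
      atTop (𝓝 0) :=
  (tendsto_rpow_smul_distribDilate_atBot hs hs0 hq₀ hq hu).comp
    (tendsto_neg_atTop_atBot.comp tendsto_natCast_atTop_atTop)

end Literature.Analysis.FunctionSpaces

end
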